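import Literature.MathematicalPhysics.QuantumFieldTheory.Balaban1983to89.T3AlphaInputsACTrivEnvelope
import Summits.QuantumFields.YangMills.Theorems.UnitScaleTiltFluctuationComparisonRegPrSmallFieldEnvelope
import Summits.QuantumFields.YangMills.Theorems.UnitScaleTiltFluctuationComparisonRegPrBudget
import HarnessLib

/-!
# Route `UnitScaleTilt` — crux `FluctuationComparisonRegPrL` (stmt-QuantumFields-19935), v5h STUB 3′ `stub_alphaTwoRunOfLane`, conjunct (A)
# `RepAtHeights`: THE SOCKET THEOREM «one-step trivial envelopes ⇒ `RepAtHeights`» (support file `--supports stmt-QuantumFields-19935`;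
# the stub stays open)

Fleet seat `ym-ust-19201-p2` (gen 3, socket pen); split card `CARD-19935-STUB3prime-split.md` (evidence #18 on the item), finding F-g3-1.
WHAT THIS IS.  `T3AlphaInputsAC.RepAtHeights D b₀ p₀ ε₀` (= `T3LogComparisonSocket.TwoSidedRepAt` at `D.PintH/EcstH/RmH`, the hypothesis the
skeleton's §2 `logComparisonRegPrL` consumes through `LogComparisonSocket.stubBody_of_rep_of_cauchy`, p452026) is the two-sided (41)/(47)
representation of the RESTRICTED height densities `heightDensity … (histGood K n)` of the route.  This file proves it from NAMED ROWS of the datum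
in `AlphaDataT3` letters (Literature `T3AlphaInputsACTrivEnvelope`, p500692): the trivial-envelope rows `TrivEnvelopeRows D b₀ p₀` (base (1), lower
one-step envelope (47)/(57), MASS-FREE upper one-step envelope (55)·(58) at `Ω = T_η`, integrability), the main-term identification at the heights
`MainTermAtHeights D b₀ p₀ ε₀` ((42) + [Balaban1985Variational] Thm 1), and the printed remainder size `RmSize D C q` — by instantiating the
hypothesis-free induction frame of the fleet lead ym-ust-19201-p1 (`LogComparisonSmallFieldEnvelope.heightDensity_sandwich_of_oneStep`: positivity of
the renormalisation transformation along `τ_{j+1} = T_j(χ_j τ_j)`) at `ℓ_j := lowerTriv D K j`, `u_j := upperTriv D K j`, `θ := θBal`, and the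
geometric bookkeeping of the remainders (`LogComparisonBudget.summable_pow_div`, p447698).

* §1 the trivial envelopes as single exponentials; their integrability from `TrivExpIntegrable`.
* §2 `rm_le_pow` / `rmH_le_pow` (`Rm^{(K)}_{K−n} ≤ |C|(1−q)⁻¹(2L^m)³·q^{n+1}`, cut-off-uniform), `rmH_nonneg`, `summable_rmH` — the two remainder
  clauses of the socket from `RmSize` ALONE (g0 card v2: «dischargeable from the printed SIZE of Rm»).
* §3 `heightDensity_sandwich_of_rows` and **`repAtHeights_of_oneStepTriv : TrivEnvelopeRows D b₀ p₀ → MainTermAtHeights D b₀ p₀ ε₀ → RmSize D C q →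
  RepAtHeights D b₀ p₀ ε₀`** (`0 ≤ γ`).
WHAT THIS IS NOT: no estimate of Bałaban's is proved; the rows are hypotheses.  For the lane's AC datum `OfV2At.dataT3c` the lower row is the reading of
its residual `Fibre57LowAC`, the upper row is `Fibre49AC` at the trivial history PLUS exact Haar compatibility `HaarCompatT3 F` (the AC trivial mass
is the obstruction — finding F-g3-1), `MainTermAtHeights` below the cut-off is `dataT3c_mainTermIsAction` + `dataT3c_uminTriv`.

References: T. Bałaban, CMP 102 (1985) 255–275 [Balaban1985UV3] ((1)–(2) p.256, (5) p.256, (41) p.266, (47) p.267, (55)–(58) pp.269–270, p.272);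
CMP 102 (1985) 277–309 [Balaban1985Variational] (Thm 1 (8) p.279); C. King, CMP 102 (1986) 649–677 [King1986] (§3.2 p.656).
-/

noncomputable section

namespace Summit.QuantumFields.YangMills.Theorems.LogComparisonRepAtHeights

open MeasureTheory Filter Topology
open Literature.MathematicalPhysics.QuantumFieldTheory.Balaban1983to89
open Literature.MathematicalPhysics.QuantumFieldTheory.Balaban1983to89.T3ContinuumYM3Torus
open Literature.MathematicalPhysics.QuantumFieldTheory.Balaban1983to89.T3LevelShift
open Literature.MathematicalPhysics.QuantumFieldTheory.Balaban1983to89.T3UnitLawDensityEML (ℰp measurableE_ℰp rt)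
open Literature.MathematicalPhysics.QuantumFieldTheory.Balaban1983to89.T3UnitScaleTilt
open Literature.MathematicalPhysics.QuantumFieldTheory.Balaban1983to89.T3RestrictedUnitDensity
open Literature.MathematicalPhysics.QuantumFieldTheory.Balaban1983to89.T3TiltDescent
open Literature.MathematicalPhysics.QuantumFieldTheory.Balaban1983to89.T3PrintedRegularMinimiser
open Literature.MathematicalPhysics.QuantumFieldTheory.Balaban1983to89.T3LogComparisonSocket
open Literature.MathematicalPhysics.QuantumFieldTheory.Balaban1983to89.T3AlphaInputsAC
open Literature.MathematicalPhysics.QuantumFieldTheory.Balaban1983to89.T3AlphaInputsACTrivEnvelope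
open Literature.MathematicalPhysics.QuantumFieldTheory.Balaban1983to89.Missing
open Summit.QuantumFields.YangMills.Theorems.LogComparisonSmallFieldEnvelope

/-! ## §1 The trivial envelopes as single exponentials -/

section Exponentials

variable {F : T3Family} {γ : ℝ} (D : AlphaDataT3 F γ)

/-- `lowerTriv_j(W) = exp((−mainT + Pint − Ecst) − Rm)` — the exponent of (47) as one exponential. [cite: Balaban1985UV3, (47) p.267] -/
theorem lowerTriv_eq_exp (K j : ℕ) (W : GaugeField (F.P K) j (Matrix.specialUnitaryGroup (Fin 2) ℂ)) :
    lowerTriv D K j W =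
      Real.exp ((-(D.mainT K j (D.triv K j) W) + D.Pint K j (D.triv K j) W - D.Ecst K j) - D.Rm K j) := by
  unfold lowerTriv expTriv
  rw [← Real.exp_add]
  congr 1
  ring

/-- `upperTriv_j(W) = exp((−mainT + Pint − Ecst) + Rm)` — the exponent of (41) at the trivial history as one exponential. [cite: Balaban1985UV3, (41) p.266] -/
theorem upperTriv_eq_exp (K j : ℕ) (W : GaugeField (F.P K) j (Matrix.specialUnitaryGroup (Fin 2) ℂ)) :
    upperTriv D K j W =
      Real.exp ((-(D.mainT K j (D.triv K j) W) + D.Pint K j (D.triv K j) W - D.Ecst K j) + D.Rm K j) := by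
  unfold upperTriv expTriv
  rw [← Real.exp_add]
  congr 1
  ring

variable {D}

/-- Integrability of the trivial envelopes from `TrivExpIntegrable` (constants times an integrable function). [cite: Balaban1985UV3, (41) p.266] -/
theorem integrable_lowerTriv (hint : TrivExpIntegrable D) {K j : ℕ} (hj : j ≤ K) :
    Integrable (lowerTriv D K j) (fieldMeasure (F.P K) j (Matrix.specialUnitaryGroup (Fin 2) ℂ)) :=
  (hint K j hj).const_mul _

/-- Integrability of the upper trivial envelope. [cite: Balaban1985UV3, (41) p.266] -/
theorem integrable_upperTriv (hint : TrivExpIntegrable D) {K j : ℕ} (hj : j ≤ K) :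
    Integrable (upperTriv D K j) (fieldMeasure (F.P K) j (Matrix.specialUnitaryGroup (Fin 2) ℂ)) :=
  (hint K j hj).const_mul _

end Exponentials

/-! ## §2 The remainder clauses of the socket from the printed size `RmSize` -/

section Remainder

variable {F : T3Family} {γ : ℝ} {D : AlphaDataT3 F γ} {C q : ℝ}

/-- Geometric bookkeeping: `Σ_{i<j} q^{K−i} ≤ q^{K+1−j}·(1−q)⁻¹` for `j ≤ K`, `0 ≤ q < 1` (the sum of (41)'s remainders is dominated by its
coarsest term). [cite: Balaban1985UV3, (41) p.266] -/
theorem sum_pow_sub_le (hq0 : 0 ≤ q) (hq1 : q < 1) {K j : ℕ} (hj : j ≤ K) :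
    ∑ i ∈ Finset.range j, q ^ (K - i) ≤ q ^ (K + 1 - j) * (1 - q)⁻¹ := by
  have hsplit : ∀ i ∈ Finset.range j, q ^ (K - i) = q ^ (K + 1 - j) * q ^ (j - 1 - i) := by
    intro i hi
    have hij := Finset.mem_range.mp hi
    rw [← pow_add]
    congr 1
    omega
  rw [Finset.sum_congr rfl hsplit, ← Finset.mul_sum]
  refine mul_le_mul_of_nonneg_left ?_ (pow_nonneg hq0 _)
  calc ∑ i ∈ Finset.range j, q ^ (j - 1 - i) = ∑ i ∈ Finset.range j, q ^ i := Finset.sum_range_reflect (fun i => q ^ i) j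
    _ ≤ (1 - q)⁻¹ := sum_le_hasSum (Finset.range j) (fun n _ => pow_nonneg hq0 n) (hasSum_geometric_of_lt_one hq0 hq1)

/-- **THE PRINTED SIZE OF THE REMAINDER, COARSEST-TERM FORM**: under `RmSize D C q`, `Rm^{(K)}_j ≤ |C|·(1−q)⁻¹·(2L^m)³·q^{K+1−j}` for `j ≤ K`
(`q^{K+1−j} = (L^{j−1}ε_K)^{κ₀}`: the remainder of (41) after `j` steps is of the order of its last term). [cite: Balaban1985UV3, (41) p.266 and (5) p.256] -/
theorem rm_le_pow (hRm : RmSize D C q) {K j : ℕ} (hj : j ≤ K) :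
    D.Rm K j ≤ |C| * (1 - q)⁻¹ * (2 * (F.L : ℝ) ^ F.m) ^ 3 * q ^ (K + 1 - j) := by
  obtain ⟨hq0, hq1, hsize⟩ := hRm
  have hS0 : 0 ≤ ∑ i ∈ Finset.range j, q ^ (K - i) := Finset.sum_nonneg fun i _ => pow_nonneg hq0 _
  have hV0 : 0 ≤ (2 * (F.L : ℝ) ^ F.m) ^ 3 := by positivity
  have hgeom := sum_pow_sub_le hq0 hq1 hj
  calc D.Rm K j ≤ C * (∑ i ∈ Finset.range j, q ^ (K - i)) * (2 * (F.L : ℝ) ^ F.m) ^ 3 := (hsize K j hj).2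
    _ ≤ |C| * (∑ i ∈ Finset.range j, q ^ (K - i)) * (2 * (F.L : ℝ) ^ F.m) ^ 3 := by
        gcongr
        exact le_abs_self C
    _ ≤ |C| * (q ^ (K + 1 - j) * (1 - q)⁻¹) * (2 * (F.L : ℝ) ^ F.m) ^ 3 := by gcongr
    _ = |C| * (1 - q)⁻¹ * (2 * (F.L : ℝ) ^ F.m) ^ 3 * q ^ (K + 1 - j) := by ring

/-- **THE HEIGHT READING OF THE REMAINDER DECAYS GEOMETRICALLY IN THE HEIGHT**: `RmH K n = Rm^{(K)}_{K−n} ≤ A·q^{n+1}` for `n ≤ K`, with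
`A = |C|(1−q)⁻¹(2L^m)³` INDEPENDENT OF THE CUT-OFF. [cite: Balaban1985UV3, (41) p.266] -/
theorem rmH_le_pow (hRm : RmSize D C q) {K n : ℕ} (hn : n ≤ K) :
    D.RmH K n ≤ |C| * (1 - q)⁻¹ * (2 * (F.L : ℝ) ^ F.m) ^ 3 * q ^ (n + 1) := by
  have h := rm_le_pow hRm (Nat.sub_le K n)
  rw [show K + 1 - (K - n) = n + 1 by omega] at h
  exact h

/-- **CLAUSE (i) OF THE SOCKET**: `0 ≤ RmH K n` for all `K, n`. [cite: Balaban1985UV3, (41) p.266] -/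
theorem rmH_nonneg (hRm : RmSize D C q) (K n : ℕ) : 0 ≤ D.RmH K n :=
  (hRm.2.2 K (K - n) (Nat.sub_le K n)).1

/-- **CLAUSE (ii) OF THE SOCKET — THE REMAINDERS ARE SUMMABLE ALONG EVERY FREE FRACTION**: for `m ≥ 1`,
`Σ_K (RmH K ⌊K/m⌋ + RmH (K+1) ⌊K/m⌋) < ∞` (both terms `≤ A·q^{⌊K/m⌋+1}`; `Σ_K q^{⌊K/m⌋} < ∞`, `LogComparisonBudget.summable_pow_div`).
[cite: Balaban1985UV3, (41) p.266] -/
theorem summable_rmH (hRm : RmSize D C q) (m : ℕ) (hm : 0 < m) :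
    Summable fun K : ℕ => D.RmH K (K / m) + D.RmH (K + 1) (K / m) := by
  have hq0 : 0 ≤ q := hRm.1
  have hq1 : q < 1 := hRm.2.1
  set A : ℝ := |C| * (1 - q)⁻¹ * (2 * (F.L : ℝ) ^ F.m) ^ 3 with hA
  have hA0 : 0 ≤ A := by
    have h1q : 0 ≤ (1 - q)⁻¹ := inv_nonneg.mpr (by linarith)
    positivity
  have hmaj : Summable fun K : ℕ => 2 * A * q ^ (K / m) :=
    (LogComparisonBudget.summable_pow_div hq0 hq1 hm).mul_left (2 * A)
  refine Summable.of_nonneg_of_le (fun K => add_nonneg (rmH_nonneg hRm K _) (rmH_nonneg hRm (K + 1) _)) (fun K => ?_) hmaj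
  have hK : K / m ≤ K := Nat.div_le_self K m
  have h1 := rmH_le_pow hRm hK
  have h2 := rmH_le_pow hRm (hK.trans (Nat.le_succ K))
  have hqle : q ^ (K / m + 1) ≤ q ^ (K / m) := pow_le_pow_of_le_one hq0 hq1.le (Nat.le_succ _)
  have hAq : A * q ^ (K / m + 1) ≤ A * q ^ (K / m) := mul_le_mul_of_nonneg_left hqle hA0
  calc D.RmH K (K / m) + D.RmH (K + 1) (K / m) ≤ A * q ^ (K / m + 1) + A * q ^ (K / m + 1) := add_le_add h1 h2
    _ ≤ A * q ^ (K / m) + A * q ^ (K / m) := add_le_add hAq hAq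
    _ = 2 * A * q ^ (K / m) := by ring

end Remainder

/-! ## §3 The socket theorem: one-step trivial envelopes ⇒ `RepAtHeights` -/

section Socket

variable {F : T3Family} {γ : ℝ} {D : AlphaDataT3 F γ} {b₀ p₀ ε₀ C q : ℝ}

/-- **THE TWO-SIDED ENVELOPE AT THE HEIGHTS FROM THE ONE-STEP ROWS** (per run, per height): under the trivial-envelope rows of `D`, for `n ≤ K`,
a.e. on the window `PlaqSmall θBal(n)` of the comparison lattice, run `K`'s restricted height density on `histGood K n` is sandwiched by the
trivial envelopes of level `K − n` read through the level identification — the frame `LogComparisonSmallFieldEnvelope.heightDensity_sandwich_of_oneStep`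
(fleet ym-ust-19201-p1) instantiated at `ℓ_j := lowerTriv D K j`, `u_j := upperTriv D K j`, `θ := θBal`. [cite: Balaban1985UV3, (41) p.266 and (47) p.267] -/
theorem heightDensity_sandwich_of_rows (hγ : 0 ≤ γ) (hrows : TrivEnvelopeRows D b₀ p₀) {K n : ℕ} (hK : n ≤ K) :
    ∀ᵐ V ∂fieldMeasure (F.P n) 0 (Matrix.specialUnitaryGroup (Fin 2) ℂ), PlaqSmall (θBal F.L γ b₀ p₀ n) V →
      lowerTriv D K (K - n) (fieldShift (F.sitesPerDir_eq (m := F.m) (K := K) (j := K - n) (m' := F.m) (K' := n) (j' := 0) (by omega)) V) ≤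
          heightDensity F γ hK (histGood F ℰp (θBal F.L γ b₀ p₀) K n) V ∧
        heightDensity F γ hK (histGood F ℰp (θBal F.L γ b₀ p₀) K n) V ≤
          upperTriv D K (K - n) (fieldShift (F.sitesPerDir_eq (m := F.m) (K := K) (j := K - n) (m' := F.m) (K' := n) (j' := 0) (by omega)) V) := by
  refine heightDensity_sandwich_of_oneStep F hγ K (θBal F.L γ b₀ p₀) (fun j => lowerTriv D K j) (fun j => upperTriv D K j) hK
    (fun j hj => integrable_lowerTriv hrows.2.2 (by omega)) (fun j hj => integrable_upperTriv hrows.2.2 (by omega)) ?_ ?_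
  · filter_upwards [hrows.1 K] with W hW
    exact hW
  · intro j hj
    have hjK : j + 1 ≤ K := by omega
    filter_upwards [(hrows.2.1 K j hjK).1, (hrows.2.1 K j hjK).2] with W h1 h2
    exact fun hW => ⟨h1 hW, h2 hW⟩

/-- **SOCKET THEOREM — CONJUNCT (A) OF v5h STUB 3′ FROM NAMED ROWS**: if a datum `D : AlphaDataT3 F γ` carries the trivial-envelope rows at the
profile `(b₀, p₀)` (`TrivEnvelopeRows`: base (1), lower one-step envelope (47)/(57), MASS-FREE upper one-step envelope (55)·(58) at `Ω = T_η`,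
integrability), its trivial-history main term read at the heights is print's background action `β_K·minActionRegPr(ε₀)` (`MainTermAtHeights`, (42) +
[Balaban1985Variational] Thm 1), and its remainders have the printed size (`RmSize`), THEN `RepAtHeights D b₀ p₀ ε₀` — [Balaban1985UV3] (41) ∧ (47) at
the trivial history for the RESTRICTED height densities of the route, two-sided with slack `Rm`, `Rm ≥ 0` and summable along every free fraction.
Hypothesis-free over the rows; the rows are what the (α) lane (+ exact Haar compatibility for the upper one, finding F-g3-1) must deliver.
[cite: Balaban1985UV3, (41) p.266 and (47) p.267; Balaban1985Variational, Thm 1 (8) p.279] -/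
theorem repAtHeights_of_oneStepTriv (hγ : 0 ≤ γ) (hrows : TrivEnvelopeRows D b₀ p₀) (hmain : MainTermAtHeights D b₀ p₀ ε₀)
    (hRm : RmSize D C q) : RepAtHeights D b₀ p₀ ε₀ := by
  refine ⟨rmH_nonneg hRm, summable_rmH hRm, fun K n h => ?_⟩
  filter_upwards [heightDensity_sandwich_of_rows hγ hrows h] with V hV hs _
  obtain ⟨h1, h2⟩ := hV hs
  rw [lowerTriv_eq_exp] at h1
  rw [upperTriv_eq_exp] at h2
  obtain ⟨-, hlog⟩ := pos_and_abs_log_sub_le_of_exp_sandwich h1 h2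
  rw [hmain K n h V hs] at hlog
  have e : Real.log (heightDensity F γ h (histGood F ℰp (θBal F.L γ b₀ p₀) K n) V) +
        (F.scheme ℰp γ).β K * minActionRegPr F n K h ε₀ V - D.PintH K n V + D.EcstH K n =
      Real.log (heightDensity F γ h (histGood F ℰp (θBal F.L γ b₀ p₀) K n) V) -
        (-((F.scheme ℰp γ).β K * minActionRegPr F n K h ε₀ V) +
          D.Pint K (K - n) (D.triv K (K - n))
            (fieldShift (F.sitesPerDir_eq (m := F.m) (K := K) (j := K - n) (m' := F.m) (K' := n) (j' := 0) (by omega)) V) -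
          D.Ecst K (K - n)) := by
    rw [D.PintH_of_le h]
    unfold AlphaDataT3.PintTriv AlphaDataT3.EcstH
    ring
  show _ ≤ D.Rm K (K - n)
  rw [e]
  exact hlog

end Socket

end Summit.QuantumFields.YangMills.Theorems.LogComparisonRepAtHeights

end
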